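import Summits.BirchSwinnertonDyer.BirchSwinnertonDyer.Theses.TwistFamilyManinDescent
import HarnessLib

/-!
# Route `TwistFamilyManinDescent`, LINE 18 (bsd-idea-3 g7): glue G18 `OrdinaryCornerOfWildDichotomy`
# (stmt-BirchSwinnertonDyer-27560, aside) — PROVED BY NAME (planner's proof, landed by the prover seat per D-0016)

Cell `pub/bsd-wall`, D-0145 line `route-BirchSwinnertonDyer-TeichmullerTwistDescent`, seat `bsd-line-ttd-p1` g11.
The item is the LINE-18 glue `K18a → K18b → K18t → OrdinaryCornerManinResidual` (stmt-27552); it was set `aside`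
when LINE 18R (`OrdinaryCornerOfSerreTateDepth`, closed) replaced the split, but it is a valid composition and its
proof is the planner's (`HOME ideas/Sketch18.lean`, `ordinaryCornerOfWildDichotomy_proof`, rc 0 against a verbatim
local copy), re-checked here against the rendered route declarations. PROOF: case split on «wild table row»; off
it the declared tame residual K18t applies verbatim; on it, level = conductor
(`IsNewformOf.level_eq_conductorNorm_of_exists_isNewformOf`, `subst`), `p ∣ c ⇒ (v < 6 ∧ BOTTOM χ)` by K18a, the
table and `v < 6` leave the unstarred rows (5;3), (7;2), (7;4), and K18b at the Legendre character
(`isQuadratic_quadraticChar_ringHomComp`, `isPrimitive_quadraticChar_ringHomComp`, `p ≠ 2`) contradicts BOTTOM.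
Pure logic over the three hypotheses; no free fact enters. BSD is NOT proved by this; Manin's conjecture is not
proved; K18a (27557), K18b (27558), K18t (27559) and the ordinary corner 27552 stay OPEN. Design: theorems only;
no definition, no named fact, no `sorry`; axioms `propext`, `Classical.choice`, `Quot.sound`.
-/

set_option autoImplicit false
-- D-0017: single-problem summit, so `Summit.BirchSwinnertonDyer.BirchSwinnertonDyer.…` repeats a namespace BY DESIGN.
set_option linter.dupNamespace false

noncomputable section

namespace Summit.BirchSwinnertonDyer.BirchSwinnertonDyer.Theorems.TwistFamilyManinDescent

open Summit.BirchSwinnertonDyer.BirchSwinnertonDyer.Theses.TwistFamilyManinDescent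
open Literature.NumberTheory.EllipticCurves.ModularForms

/-- **Glue G18 `OrdinaryCornerOfWildDichotomy` (stmt-BirchSwinnertonDyer-27560), proved by name**:
`OrdinaryCornerWildEdixhovenDichotomy → OrdinaryCornerUnstarredNotBottom → OrdinaryCornerTameManinResidual →
OrdinaryCornerManinResidual` (planner bsd-idea-3 g7's LINE-18 composition). [cite: EdixhovenManin1991, Props. 7–9
and §4] -/
theorem ordinaryCornerOfWildDichotomy_proof : OrdinaryCornerOfWildDichotomy := by
  unfold OrdinaryCornerOfWildDichotomy
  intro hA hB hT
  unfold OrdinaryCornerManinResidual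
  intro hM hAU hC hnf W _ _ N _ D p hp h57 hRay hSS hN hirr hadd hopt
  by_cases hw : (((p = 5 ∧ padicValInt 5 W.minimalDiscriminantInt ∈ ({3, 9} : Finset ℕ)) ∨
      (p = 7 ∧ padicValInt 7 W.minimalDiscriminantInt ∈ ({2, 4, 8, 10} : Finset ℕ))) ∧
      ¬ (∀ v : IsDedekindDomain.HeightOneSpectrum (NumberField.RingOfIntegers ℚ),
        ((p : ℕ) : NumberField.RingOfIntegers ℚ) ∈ v.asIdeal → ∀ 𝔓 ∈ v.primesAbove,
        ∀ σ ∈ 𝔓.inertia (Field.absoluteGaloisGroup ℚ), ∀ P : ↥(W.geomTorsion (p : ℤ)), (σ ^ (p - 1)) • P = P))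
  · obtain ⟨hrows, hwild⟩ := hw
    haveI : Fact p.Prime := ⟨hp⟩
    have hNc : N = W.conductorNorm ℤ :=
      IsNewformOf.level_eq_conductorNorm_of_exists_isNewformOf hnf D.isNewformOf
    subst hNc
    intro hdvd
    obtain ⟨hv6, hbot⟩ := hA W p D hN hrows hirr hopt hwild hdvd
    have hrows' : (p = 5 ∧ padicValInt 5 W.minimalDiscriminantInt = 3) ∨
        (p = 7 ∧ padicValInt 7 W.minimalDiscriminantInt ∈ ({2, 4} : Finset ℕ)) := by
      rcases hrows with ⟨hp5, h⟩ | ⟨hp7, h⟩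
      · subst hp5
        refine Or.inl ⟨rfl, ?_⟩
        simp only [Finset.mem_insert, Finset.mem_singleton] at h
        rcases h with h | h
        · exact h
        · exfalso; rw [h] at hv6; exact absurd hv6 (by norm_num)
      · subst hp7
        refine Or.inr ⟨rfl, ?_⟩
        simp only [Finset.mem_insert, Finset.mem_singleton] at h ⊢
        rcases h with h | h | h | h
        · exact Or.inl h
        · exact Or.inr h
        · exfalso; rw [h] at hv6; exact absurd hv6 (by norm_num)
        · exfalso; rw [h] at hv6; exact absurd hv6 (by norm_num)
    have hp2 : p ≠ 2 := by rcases h57 with rfl | rfl <;> decide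
    exact hB W p D hN hrows' hirr hopt hwild _ (isQuadratic_quadraticChar_ringHomComp p)
      (isPrimitive_quadraticChar_ringHomComp p hp2)
      (hbot _ (isQuadratic_quadraticChar_ringHomComp p) (isPrimitive_quadraticChar_ringHomComp p hp2))
  · exact hT hM hAU hC hnf W D p hp h57 hRay hSS hN hirr hadd hopt hw

end Summit.BirchSwinnertonDyer.BirchSwinnertonDyer.Theorems.TwistFamilyManinDescent

end
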